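import Summits.HubbardSuperconductivity.HubbardSuperconductivity.Theorems.BalabanIRBirBdGPhaseCoercivityTrigPoly

/-!
# Route BalabanIR — crux 3 `BirBdGPhaseCoercivity` (item `stmt-HubbardSuperconductivity-2081`):
# XI. The one-loop numerator as a double character sum; aliasing-free evaluation against a
# trigonometric multiplier; the second-order bound

For the symbol inequality (★) of `BirBdG.coercive_of_symbolIneq` write its summand as `N(k,q)/E_k`,
`N(k,q) = 2|Δ_k|² - ¼(|Δ_k + Δ_{k+q}|² + |Δ_k + Δ_{k-q}|²)`. With the bond expansion
`Δ_k = Σ_{r∈B} c_r χ_r(k)` (file X):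
* `numerator_eq_sum_sum` — `N(k,q) = Σ_{r,r'∈B} c_r conj(c_{r'}) w_{rr'}(q) χ_{r-r'}(k)` with the REAL,
  NONNEGATIVE weights `w_{rr'}(q) = ½(3 - cos q·r - cos q·r' - cos q·(r-r'))`, which vanish to second
  order at `q = 0`;
* `sum_numerator_mul_trigPoly` — for a trigonometric multiplier `m(k) = Σ_ρ a_ρ χ_ρ(k)` of
  coordinate degree `≤ D` and `L ≥ D + 3`: `Σ_k N(k,q) m(k) = L² Σ_{r,r'} c_r conj(c_{r'}) w_{rr'}(q) a_{r'-r}`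
  EXACTLY (only the 25 low coefficients of `m` enter);
* `abs_numerator_le` — `|N(k,q)| ≤ 48(|Δ₁|+|Δ₂|)² ε(q)`, `ε(q) = 4 - 2cos q₀ - 2cos q₁`.

References: the evidence note `Prover1_2081_symbol_inequality_proof_scheme.md` on the item; Friedli–Velenik
2017, §10.4. No definition is introduced.
-/

noncomputable section

namespace Summit.HubbardSuperconductivity.HubbardSuperconductivity.Theorems

namespace BirBdG

open Matrix Finset Literature.Probability.LatticeModels
open scoped ComplexConjugate

/-! ### Elementary trigonometric inequalities -/

/-- `1 - cos(a + b) ≤ 2(1 - cos a) + 2(1 - cos b)`. [folklore] -/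
theorem one_sub_cos_add_le (a b : ℝ) :
    1 - Real.cos (a + b) ≤ 2 * (1 - Real.cos a) + 2 * (1 - Real.cos b) := by
  rw [Real.cos_add]
  nlinarith [sq_nonneg (Real.sin a - Real.sin b), Real.sin_sq_add_cos_sq a, Real.sin_sq_add_cos_sq b,
    sq_nonneg (Real.cos a - Real.cos b), mul_nonneg (sub_nonneg.2 (Real.cos_le_one a))
      (sub_nonneg.2 (Real.cos_le_one b)), Real.neg_one_le_cos a, Real.neg_one_le_cos b]

/-- `1 - cos(j a) ≤ 4(1 - cos a)` for an integer `|j| ≤ 2`. [folklore] -/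
theorem one_sub_cos_int_mul_le {j : ℤ} (hj : |j| ≤ 2) (a : ℝ) :
    1 - Real.cos (j * a) ≤ 4 * (1 - Real.cos a) := by
  have h0 : 0 ≤ 1 - Real.cos a := sub_nonneg.2 (Real.cos_le_one a)
  have hcases : j = -2 ∨ j = -1 ∨ j = 0 ∨ j = 1 ∨ j = 2 := by
    rcases abs_le.1 hj with ⟨h1, h2⟩
    omega
  rcases hcases with rfl | rfl | rfl | rfl | rfl
  · have := one_sub_cos_add_le (-a) (-a)
    rw [Real.cos_neg] at this
    push_cast
    rw [show (-2 : ℝ) * a = -a + -a by ring]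
    linarith
  · push_cast; rw [neg_one_mul, Real.cos_neg]; linarith
  · push_cast; rw [zero_mul, Real.cos_zero]; linarith
  · push_cast; rw [one_mul]; linarith
  · have := one_sub_cos_add_le a a
    push_cast
    rw [show (2 : ℝ) * a = a + a by ring]
    linarith

/-- For a frequency `s` with `|s₀|, |s₁| ≤ 2`: `1 - cos(s₀θ₀ + s₁θ₁) ≤ 4 ε(θ)` with
`ε(θ) = 4 - 2cos θ₀ - 2cos θ₁`. [folklore] -/
theorem one_sub_cos_freq_le {s : ℤ × ℤ} (h0 : |s.1| ≤ 2) (h1 : |s.2| ≤ 2) (θ₀ θ₁ : ℝ) :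
    1 - Real.cos (s.1 * θ₀ + s.2 * θ₁) ≤ 4 * (4 - 2 * Real.cos θ₀ - 2 * Real.cos θ₁) := by
  have := one_sub_cos_add_le (s.1 * θ₀) (s.2 * θ₁)
  have ha := one_sub_cos_int_mul_le h0 θ₀
  have hb := one_sub_cos_int_mul_le h1 θ₁
  linarith

/-! ### The bond data -/

/-- Every bond coefficient is bounded by `|Δ₁| + |Δ₂|`. [folklore] -/
theorem norm_bondCoeff_le (Δ₁ Δ₂ : ℝ) (r : ℤ × ℤ) :
    ‖(if (r = (1, 0) ∨ r = (-1, 0)) then (Δ₁ : ℂ) else if (r = (0, 1) ∨ r = (0, -1)) then -(Δ₁ : ℂ)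
        else if (r = (1, 1) ∨ r = (-1, -1)) then Complex.I * (Δ₂ : ℂ) else -(Complex.I * (Δ₂ : ℂ)))‖ ≤
      |Δ₁| + |Δ₂| := by
  have h1 : 0 ≤ |Δ₁| := abs_nonneg _
  have h2 : 0 ≤ |Δ₂| := abs_nonneg _
  split_ifs <;> simp [Complex.norm_real, Real.norm_eq_abs, norm_neg, Complex.norm_I]

/-- The bond vectors have coordinates of absolute value `≤ 1`. [folklore] -/
theorem abs_le_one_of_mem_bonds {r : ℤ × ℤ}
    (hr : r ∈ ({(1, 0), (-1, 0), (0, 1), (0, -1), (1, 1), (-1, -1), (1, -1), (-1, 1)} : Finset (ℤ × ℤ))) :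
    |r.1| ≤ 1 ∧ |r.2| ≤ 1 := by
  simp only [Finset.mem_insert, Finset.mem_singleton] at hr
  rcases hr with rfl | rfl | rfl | rfl | rfl | rfl | rfl | rfl <;> simp

/-! ### Norm-square of a finite sum as a double sum -/

/-- `|Σ_r f r|² = Σ_r Σ_{r'} f r · conj (f r')` (as a complex number). [folklore] -/
theorem ofReal_norm_sq_sum_eq {ι : Type*} (s : Finset ι) (f : ι → ℂ) :
    (((‖∑ r ∈ s, f r‖ ^ 2 : ℝ)) : ℂ) = ∑ r ∈ s, ∑ r' ∈ s, f r * conj (f r') := by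
  rw [← Complex.normSq_eq_norm_sq, ← Complex.mul_conj, map_sum, Finset.sum_mul_sum]

/-! ### The numerator as a double character sum -/

section Numerator

variable {L : ℕ} [NeZero L]

/-- Real parts of grid characters at integer frequencies: `χ_ρ(q) + conj χ_ρ(q) = 2cos(ρ·θ_q)`. [cite: FriedliVelenik2017, §10.4] -/
theorem torusChar_intFreq_add_conj (ρ : ℤ × ℤ) (q : TorusSite 2 L) :
    torusChar (![((ρ.1 : ℤ) : ZMod L), ((ρ.2 : ℤ) : ZMod L)] : TorusSite 2 L) q +
        conj (torusChar (![((ρ.1 : ℤ) : ZMod L), ((ρ.2 : ℤ) : ZMod L)] : TorusSite 2 L) q) =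
      ((2 * Real.cos (ρ.1 * latticeMomentum L q 0 + ρ.2 * latticeMomentum L q 1) : ℝ) : ℂ) := by
  rw [Complex.add_conj, torusChar_intFreq_eq_exp, mul_comm Complex.I, Complex.exp_ofReal_mul_I_re]

/-- Mixed products of grid characters at integer frequencies:
`χ_ρ(q) conj χ_σ(q) + conj χ_ρ(q) χ_σ(q) = 2cos((ρ-σ)·θ_q)`. [cite: FriedliVelenik2017, §10.4] -/
theorem torusChar_intFreq_mul_conj_add (ρ σ : ℤ × ℤ) (q : TorusSite 2 L) :
    torusChar (![((ρ.1 : ℤ) : ZMod L), ((ρ.2 : ℤ) : ZMod L)] : TorusSite 2 L) q *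
        conj (torusChar (![((σ.1 : ℤ) : ZMod L), ((σ.2 : ℤ) : ZMod L)] : TorusSite 2 L) q) +
      conj (torusChar (![((ρ.1 : ℤ) : ZMod L), ((ρ.2 : ℤ) : ZMod L)] : TorusSite 2 L) q) *
        torusChar (![((σ.1 : ℤ) : ZMod L), ((σ.2 : ℤ) : ZMod L)] : TorusSite 2 L) q =
      ((2 * Real.cos ((ρ.1 - σ.1) * latticeMomentum L q 0 + (ρ.2 - σ.2) * latticeMomentum L q 1) : ℝ) : ℂ) := by
  have h : torusChar (![((ρ.1 : ℤ) : ZMod L), ((ρ.2 : ℤ) : ZMod L)] : TorusSite 2 L) q *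
      conj (torusChar (![((σ.1 : ℤ) : ZMod L), ((σ.2 : ℤ) : ZMod L)] : TorusSite 2 L) q) =
      Complex.exp ((((ρ.1 - σ.1) * latticeMomentum L q 0 + (ρ.2 - σ.2) * latticeMomentum L q 1 : ℝ) : ℂ) *
        Complex.I) := by
    rw [torusChar_intFreq_eq_exp, torusChar_intFreq_eq_exp, ← Complex.exp_conj, ← Complex.exp_add,
      map_mul, Complex.conj_I, Complex.conj_ofReal]
    congr 1
    push_cast
    ring
  have h' : conj (torusChar (![((ρ.1 : ℤ) : ZMod L), ((ρ.2 : ℤ) : ZMod L)] : TorusSite 2 L) q) *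
      torusChar (![((σ.1 : ℤ) : ZMod L), ((σ.2 : ℤ) : ZMod L)] : TorusSite 2 L) q =
      conj (torusChar (![((ρ.1 : ℤ) : ZMod L), ((ρ.2 : ℤ) : ZMod L)] : TorusSite 2 L) q *
        conj (torusChar (![((σ.1 : ℤ) : ZMod L), ((σ.2 : ℤ) : ZMod L)] : TorusSite 2 L) q)) := by
    rw [map_mul, Complex.conj_conj, mul_comm]
  rw [h', h, Complex.add_conj, Complex.exp_ofReal_mul_I_re]

/-- **The one-loop numerator as a double character sum.** If `Δ_k = Σ_{r∈B} c_r χ_r(k)` on the grid,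
then `2|Δ_k|² - ¼(|Δ_k + Δ_{k+q}|² + |Δ_k + Δ_{k-q}|²) = Σ_{r,r'∈B} c_r conj(c_{r'}) w_{rr'}(q) χ_r(k) conj χ_{r'}(k)`
with `w_{rr'}(q) = ½(3 - cos q·r - cos q·r' - cos q·(r-r'))` (stated for an arbitrary finite set of integer
frequencies `B` and coefficients `c`). [folklore] -/
theorem numerator_eq_sum_sum (B : Finset (ℤ × ℤ)) (c : ℤ × ℤ → ℂ) (Δ : TorusSite 2 L → ℂ)
    (hΔ : ∀ k, Δ k = ∑ r ∈ B, c r * torusChar (![((r.1 : ℤ) : ZMod L), ((r.2 : ℤ) : ZMod L)] : TorusSite 2 L) k)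
    (k q : TorusSite 2 L) :
    (((2 * ‖Δ k‖ ^ 2 - (‖Δ k + Δ (k + q)‖ ^ 2 + ‖Δ k + Δ (k - q)‖ ^ 2) / 4 : ℝ)) : ℂ) =
      ∑ r ∈ B, ∑ r' ∈ B, c r * conj (c r') *
        (((3 - Real.cos (r.1 * latticeMomentum L q 0 + r.2 * latticeMomentum L q 1)
            - Real.cos (r'.1 * latticeMomentum L q 0 + r'.2 * latticeMomentum L q 1)
            - Real.cos ((r.1 - r'.1) * latticeMomentum L q 0 + (r.2 - r'.2) * latticeMomentum L q 1)) / 2 : ℝ) : ℂ) *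
        (torusChar (![((r.1 : ℤ) : ZMod L), ((r.2 : ℤ) : ZMod L)] : TorusSite 2 L) k *
          conj (torusChar (![((r'.1 : ℤ) : ZMod L), ((r'.2 : ℤ) : ZMod L)] : TorusSite 2 L) k)) := by
  -- grid characters at `k` and `q`
  set χ : ℤ × ℤ → ℂ := fun r => torusChar (![((r.1 : ℤ) : ZMod L), ((r.2 : ℤ) : ZMod L)] : TorusSite 2 L) k
    with hχ
  set ψ : ℤ × ℤ → ℂ := fun r => torusChar (![((r.1 : ℤ) : ZMod L), ((r.2 : ℤ) : ZMod L)] : TorusSite 2 L) q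
    with hψ
  have hZ : Δ k = ∑ r ∈ B, c r * χ r := hΔ k
  have hZp : Δ k + Δ (k + q) = ∑ r ∈ B, c r * χ r * (1 + ψ r) := by
    rw [hΔ k, hΔ (k + q), ← Finset.sum_add_distrib]
    refine Finset.sum_congr rfl fun r _ => ?_
    rw [torusChar_add_right]
    ring
  have hZm : Δ k + Δ (k - q) = ∑ r ∈ B, c r * χ r * (1 + conj (ψ r)) := by
    rw [hΔ k, hΔ (k - q), ← Finset.sum_add_distrib]
    refine Finset.sum_congr rfl fun r _ => ?_
    rw [torusChar_sub_right]
    ring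
  simp only [Complex.ofReal_sub, Complex.ofReal_mul, Complex.ofReal_add, Complex.ofReal_div,
    Complex.ofReal_ofNat]
  rw [hZp, hZm, hZ, ofReal_norm_sq_sum_eq, ofReal_norm_sq_sum_eq, ofReal_norm_sq_sum_eq]
  rw [Finset.mul_sum, ← Finset.sum_add_distrib, Finset.sum_div, ← Finset.sum_sub_distrib]
  refine Finset.sum_congr rfl fun r _ => ?_
  rw [Finset.mul_sum, ← Finset.sum_add_distrib, Finset.sum_div, ← Finset.sum_sub_distrib]
  refine Finset.sum_congr rfl fun r' _ => ?_
  -- the scalar identity per pair `(r, r')`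
  have hc1 : ψ r + conj (ψ r) =
      ((2 * Real.cos (r.1 * latticeMomentum L q 0 + r.2 * latticeMomentum L q 1) : ℝ) : ℂ) :=
    torusChar_intFreq_add_conj r q
  have hc2 : ψ r' + conj (ψ r') =
      ((2 * Real.cos (r'.1 * latticeMomentum L q 0 + r'.2 * latticeMomentum L q 1) : ℝ) : ℂ) :=
    torusChar_intFreq_add_conj r' q
  have hc3 : ψ r * conj (ψ r') + conj (ψ r) * ψ r' =
      ((2 * Real.cos ((r.1 - r'.1) * latticeMomentum L q 0 + (r.2 - r'.2) * latticeMomentum L q 1) : ℝ) : ℂ) :=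
    torusChar_intFreq_mul_conj_add r r' q
  simp only [map_mul, map_add, map_one, Complex.conj_conj]
  have key : 2 * (c r * χ r * (conj (c r') * conj (χ r'))) -
      (c r * χ r * (1 + ψ r) * (conj (c r') * conj (χ r') * (1 + conj (ψ r'))) +
        c r * χ r * (1 + conj (ψ r)) * (conj (c r') * conj (χ r') * (1 + ψ r'))) / 4 =
      c r * conj (c r') * ((3 - (ψ r + conj (ψ r)) / 2 - (ψ r' + conj (ψ r')) / 2 -
        (ψ r * conj (ψ r') + conj (ψ r) * ψ r') / 2) / 2) * (χ r * conj (χ r')) := by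
    ring
  rw [key, hc1, hc2, hc3]
  push_cast
  ring

/-- `χ_{k+k'}(x) = χ_k(x) χ_{k'}(x)` (characters in the frequency variable). [cite: FriedliVelenik2017, §10.4] -/
theorem torusChar_add_left' {d : ℕ} (k k' x : TorusSite d L) :
    torusChar (k + k') x = torusChar k x * torusChar k' x := by
  rw [torusChar_comm, torusChar_add_right, torusChar_comm x k, torusChar_comm x k']

/-- The triple character product met in the aliasing-free evaluation:
`χ_r(k) conj χ_{r'}(k) χ_ρ(k) = χ_{r - r' + ρ}(k)`. [folklore] -/
theorem torusChar_triple (r r' ρ : ℤ × ℤ) (k : TorusSite 2 L) :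
    torusChar (![((r.1 : ℤ) : ZMod L), ((r.2 : ℤ) : ZMod L)] : TorusSite 2 L) k *
        conj (torusChar (![((r'.1 : ℤ) : ZMod L), ((r'.2 : ℤ) : ZMod L)] : TorusSite 2 L) k) *
        torusChar (![((ρ.1 : ℤ) : ZMod L), ((ρ.2 : ℤ) : ZMod L)] : TorusSite 2 L) k =
      torusChar (![(((r - r' + ρ).1 : ℤ) : ZMod L), (((r - r' + ρ).2 : ℤ) : ZMod L)] : TorusSite 2 L) k := by
  rw [← torusChar_sub_left, ← torusChar_add_left']
  congr 1
  ext i; fin_cases i <;> simp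

/-- **Aliasing-free evaluation of the numerator against a trigonometric multiplier.** If
`Δ_k = Σ_{r∈B} c_r χ_r(k)` with `|r|_∞ ≤ 1` on `B`, `m(k) = Σ_{ρ ∈ supp a} a_ρ χ_ρ(k)` with
`|ρ|_∞ ≤ D` on `supp a`, and `L ≥ D + 3`, then
`Σ_k N(k,q) m(k) = L² Σ_{r,r'∈B} c_r conj(c_{r'}) w_{rr'}(q) a_{r'-r}` exactly. [folklore] -/
theorem sum_numerator_mul_trigPoly (B : Finset (ℤ × ℤ)) (hB : ∀ r ∈ B, |r.1| ≤ 1 ∧ |r.2| ≤ 1)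
    (c : ℤ × ℤ → ℂ) (Δ : TorusSite 2 L → ℂ)
    (hΔ : ∀ k, Δ k = ∑ r ∈ B, c r * torusChar (![((r.1 : ℤ) : ZMod L), ((r.2 : ℤ) : ZMod L)] : TorusSite 2 L) k)
    (a : (ℤ × ℤ) →₀ ℂ) (D : ℕ) (hsupp : ∀ ρ ∈ a.support, |ρ.1| ≤ D ∧ |ρ.2| ≤ D) (hL : D + 3 ≤ L)
    (q : TorusSite 2 L) :
    ∑ k : TorusSite 2 L, (((2 * ‖Δ k‖ ^ 2 - (‖Δ k + Δ (k + q)‖ ^ 2 + ‖Δ k + Δ (k - q)‖ ^ 2) / 4 : ℝ)) : ℂ) *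
        (∑ ρ ∈ a.support, a ρ * torusChar (![((ρ.1 : ℤ) : ZMod L), ((ρ.2 : ℤ) : ZMod L)] : TorusSite 2 L) k) =
      ((L : ℂ) ^ 2) * ∑ r ∈ B, ∑ r' ∈ B, c r * conj (c r') *
        (((3 - Real.cos (r.1 * latticeMomentum L q 0 + r.2 * latticeMomentum L q 1)
            - Real.cos (r'.1 * latticeMomentum L q 0 + r'.2 * latticeMomentum L q 1)
            - Real.cos ((r.1 - r'.1) * latticeMomentum L q 0 + (r.2 - r'.2) * latticeMomentum L q 1)) / 2 : ℝ) : ℂ) *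
        a (r' - r) := by
  simp_rw [numerator_eq_sum_sum B c Δ hΔ _ q, Finset.sum_mul, Finset.mul_sum]
  -- bring the `k`-sum inside
  rw [Finset.sum_comm]
  refine Finset.sum_congr rfl fun r hr => ?_
  rw [Finset.sum_comm]
  refine Finset.sum_congr rfl fun r' hr' => ?_
  rw [Finset.sum_comm]
  -- the `k`-sum of the triple product, frequency by frequency
  have hk : ∀ ρ ∈ a.support,
      ∑ k : TorusSite 2 L, c r * conj (c r') *
          (((3 - Real.cos (r.1 * latticeMomentum L q 0 + r.2 * latticeMomentum L q 1)
            - Real.cos (r'.1 * latticeMomentum L q 0 + r'.2 * latticeMomentum L q 1)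
            - Real.cos ((r.1 - r'.1) * latticeMomentum L q 0 + (r.2 - r'.2) * latticeMomentum L q 1)) / 2 : ℝ) : ℂ) *
          (torusChar (![((r.1 : ℤ) : ZMod L), ((r.2 : ℤ) : ZMod L)] : TorusSite 2 L) k *
            conj (torusChar (![((r'.1 : ℤ) : ZMod L), ((r'.2 : ℤ) : ZMod L)] : TorusSite 2 L) k)) *
          (a ρ * torusChar (![((ρ.1 : ℤ) : ZMod L), ((ρ.2 : ℤ) : ZMod L)] : TorusSite 2 L) k) =
        c r * conj (c r') *
          (((3 - Real.cos (r.1 * latticeMomentum L q 0 + r.2 * latticeMomentum L q 1)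
            - Real.cos (r'.1 * latticeMomentum L q 0 + r'.2 * latticeMomentum L q 1)
            - Real.cos ((r.1 - r'.1) * latticeMomentum L q 0 + (r.2 - r'.2) * latticeMomentum L q 1)) / 2 : ℝ) : ℂ) *
          a ρ * (if r - r' + ρ = 0 then ((L : ℂ) ^ 2) else 0) := by
    intro ρ hρ
    have hb := hB r hr
    have hb' := hB r' hr'
    have hs := hsupp ρ hρ
    have h0 : |(r - r' + ρ).1| < L := by
      have : |(r - r' + ρ).1| ≤ |r.1| + |r'.1| + |ρ.1| := by
        simp only [Prod.fst_add, Prod.fst_sub]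
        calc |r.1 - r'.1 + ρ.1| ≤ |r.1 - r'.1| + |ρ.1| := abs_add_le _ _
          _ ≤ |r.1| + |r'.1| + |ρ.1| := by linarith [abs_sub (r.1) (r'.1)]
      have hL' : ((D + 3 : ℕ) : ℤ) ≤ (L : ℤ) := by exact_mod_cast hL
      push_cast at hL'
      linarith [hb.1, hb'.1, hs.1]
    have h1 : |(r - r' + ρ).2| < L := by
      have : |(r - r' + ρ).2| ≤ |r.2| + |r'.2| + |ρ.2| := by
        simp only [Prod.snd_add, Prod.snd_sub]
        calc |r.2 - r'.2 + ρ.2| ≤ |r.2 - r'.2| + |ρ.2| := abs_add_le _ _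
          _ ≤ |r.2| + |r'.2| + |ρ.2| := by linarith [abs_sub (r.2) (r'.2)]
      have hL' : ((D + 3 : ℕ) : ℤ) ≤ (L : ℤ) := by exact_mod_cast hL
      push_cast at hL'
      linarith [hb.2, hb'.2, hs.2]
    have hsum := sum_torusChar_intFreq (L := L) (r - r' + ρ) h0 h1
    rw [← hsum, Finset.mul_sum]
    refine Finset.sum_congr rfl fun k _ => ?_
    rw [← torusChar_triple r r' ρ k]
    ring
  rw [Finset.sum_congr rfl hk]
  -- only `ρ = r' - r` survives
  have hsel : ∀ ρ : ℤ × ℤ, (if r - r' + ρ = 0 then ((L : ℂ) ^ 2) else 0) =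
      (if ρ = r' - r then ((L : ℂ) ^ 2) else 0) := by
    intro ρ
    have : (r - r' + ρ = 0) ↔ (ρ = r' - r) := by
      constructor
      · intro h; have := congrArg (fun x => x - (r - r')) h; simp at this; rw [this]
      · rintro rfl; abel
    simp only [this]
  simp_rw [hsel, mul_ite, mul_zero]
  rw [Finset.sum_ite_eq' a.support (r' - r)]
  by_cases hmem : r' - r ∈ a.support
  · rw [if_pos hmem]; ring
  · rw [if_neg hmem, Finsupp.notMem_support_iff.1 hmem]; ring

end Numerator


end BirBdG

end Summit.HubbardSuperconductivity.HubbardSuperconductivity.Theorems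

end
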